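import Literature.AlgebraicGeometry.ShimuraVarieties.UnitaryCurveSpecialPairReciprocity          -- ★ `IsArtinCorrespondent.mul_unitEmbedding_inv` (totally complex)
import Literature.AlgebraicGeometry.ShimuraVarieties.UnitaryAuxiliaryReflexArtinSurjective        -- ★ `exists_finiteIdele_isArtinCorrespondent_reflexField`, `isTotallyComplex_reflexField`
import Literature.AlgebraicGeometry.ShimuraVarieties.UnitaryAuxiliaryReflexBookkeeping           -- ★ `reflexField_eq_fieldRange_of_isGalois` (`E♯ = ι₁(F)` for `F ∕ ℚ` Galois)
import Literature.NumberTheory.LFunctions.RayClassSplitPrimeIdeleRepresentative                   -- ★ p849740 split-prime idèle representatives (+ ★ p849693 integral ones)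
import HarnessLib

/-!
# Artin correspondents with a PRESCRIBED ideal: level-adapted integral ∕ totally split degree-one prime representatives inside the class of `σ`,
# over any totally complex number field and over the reflex compositum `E♯`

Topic `AlgebraicGeometry/ShimuraVarieties` (sequel of ★ `UnitaryShimuraCanonicalModel*.lean`, the `IsArtinCorrespondent` story); namespace
`Literature.AlgebraicGeometry.ShimuraVarieties.UnitaryCanonicalModel` (dot-notation on ★ `IsArtinCorrespondent`).  THEOREMS ONLY (no definition, no
instance, no notation, no named fact, no `sorry`).  Cell `hodgecm-mathlib`, crux hLiu418 (`stmt-HodgeConjecture-24832`), organ (S6) «TWIST DATA» of the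
sheet line `stub_ESHEET` (LA5-plan (g3) DEAL L5-#4 → LA7-p02 (g3)), follow-up (S6++): the (S2a) reciprocity law ★
`UnitaryCurve.AuxV.exists_siegelRecipDatum_centralTwist` reads the central twist `t = N_{E♯,Φ}(u)` off an Artin correspondent `u` of `σ` OVER THE REFLEX
COMPOSITUM `E♯ = reflexField F Φ ι₁`; to control the twist IDEAL `(t)` (integral, prime to the level, coprime to its conjugate) and its LEVEL (`t ≡ 1 mod N`)
the closer must choose `u` — this file supplies the choices.  HC_CM is proved only modulo the printed citations until rung 0 closes; nothing here is about HC.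

THE MATHEMATICS ([Milne2005ShimuraVarieties] (59) p. 107: `art_E(s) = σ|E^{ab}` determines `s` up to `E^× · (identity component)`; [NeukirchANT1999] VI (1.9);
[Landau1918Idealklassen] §1).  The class of Artin correspondents of `σ` is stable under principal finite idèles when the field is TOTALLY COMPLEX (★
`IsArtinCorrespondent.mul_unitEmbedding_inv`: the archimedean idèles are connected), so the ray-class representatives of ★ `RayClassIntegralIdeleRepresentative`
(integral, `≡ 1 mod 𝔪`) and ★ `RayClassSplitPrimeIdeleRepresentative` (a totally split degree-one prime outside any finite set, `≡ 1 mod 𝔪`) can be taken INSIDE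
the class: §1, for every totally complex number field `K` (★ `Theorems/F0P6aTwistData` §2 and ★ `Theorems/F0P6aTwistDataCoprime` §2 stated this for CM fields
only).  §2: for `F ∕ ℚ` Galois the reflex compositum `E♯ = ι₁(F)` (★ `reflexField_eq_fieldRange_of_isGalois`) IS GALOIS over `ℚ` (`isGalois_reflexField_of_isGalois`,
transport along `F ≃ₐ[ℚ] ι₁(F) = E♯`), so §1 applies in `E♯` with the split-prime injectivity; §3 the one-call forms over `E♯` consumed by the sheet line:
every `σ ∈ Aut(ℂ∕E♯)` has a correspondent `u ∈ 𝔸_{E♯,f}^×` with `(u) = 𝔮` a totally split degree-one prime of `E♯` outside any finite set, `𝔮 ∤ 𝔪`, `u ≡ 1 mod 𝔪`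
(★ `exists_finiteIdele_isArtinCorrespondent_reflexField` + §1).

[cite: Milne2005ShimuraVarieties, (59) p. 107; Def. 12.8 (62) p. 114] [cite: NeukirchANT1999, Ch. VI §1 Prop. (1.9) pp. 364–365] [cite: Landau1918Idealklassen, §1 Satz]
[cite: Shimura1998, §8.3 Prop. 28; §18.6 p. 128]
-/

set_option autoImplicit false

noncomputable section

open NumberField IsDedekindDomain
open scoped nonZeroDivisors Pointwise
open Literature.NumberTheory.GaloisRepresentations (modulusExp)

namespace Literature.AlgebraicGeometry.ShimuraVarieties

namespace UnitaryCanonicalModel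

/-! ## §1 Any totally complex number field: representatives inside the class of an Artin correspondent -/

section TotallyComplex

variable (K : Type) [Field K] [NumberField K] [IsTotallyComplex K]

/-- **Level-adapted INTEGRAL representative inside the class** (`K` totally complex): if `s ↔ σ` then `s·a ↔ σ` for some `a ∈ Kˣ` with `(s·a) = 𝔟` integral,
`𝔟 + 𝔪 = (1)`, and `|s_v a|_v = 1`, `|s_v a − 1|_v ≤ q_v^{-n_v}` at every prime of `𝔪` — ★ `exists_mul_unitEmbedding_integral_congr` moved inside the class by
★ `IsArtinCorrespondent.mul_unitEmbedding_inv`. [cite: Milne2005ShimuraVarieties, (59) p. 107] [cite: NeukirchANT1999, Ch. VI §1 Prop. (1.9) pp. 364–365] -/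
theorem IsArtinCorrespondent.exists_mul_unitEmbedding_integral_congr {τ : K →+* ℂ} {σ : ℂ ≃+* ℂ} {s : (FiniteAdeleRing (𝓞 K) K)ˣ}
    (hs : IsArtinCorrespondent K τ s σ) {𝔪 : Ideal (𝓞 K)} (h𝔪 : 𝔪 ≠ ⊥) :
    ∃ (a : Kˣ) (𝔟 : Ideal (𝓞 K)),
      IsArtinCorrespondent K τ (s * FiniteAdeleRing.unitEmbedding (𝓞 K) K a) σ ∧ 𝔟 ≠ ⊥ ∧ IsCoprime 𝔟 𝔪 ∧
      Literature.NumberTheory.Automorphic.FiniteAdeleRing.toFractionalIdeal (𝓞 K) K (s * FiniteAdeleRing.unitEmbedding (𝓞 K) K a) =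
        (𝔟 : FractionalIdeal (𝓞 K)⁰ K) ∧
      ∀ v : HeightOneSpectrum (𝓞 K), 𝔪 ≤ v.asIdeal →
        Valued.v (((s * FiniteAdeleRing.unitEmbedding (𝓞 K) K a : (FiniteAdeleRing (𝓞 K) K)ˣ) : FiniteAdeleRing (𝓞 K) K) v) = 1 ∧
        Valued.v (((s * FiniteAdeleRing.unitEmbedding (𝓞 K) K a : (FiniteAdeleRing (𝓞 K) K)ˣ) : FiniteAdeleRing (𝓞 K) K) v - 1) ≤
          WithZero.exp (-(modulusExp 𝔪 v : ℤ)) := by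
  obtain ⟨a, 𝔟, h𝔟, hcop, hid, hv⟩ :=
    Literature.NumberTheory.GaloisRepresentations.exists_mul_unitEmbedding_integral_congr h𝔪 s
  refine ⟨a, 𝔟, ?_, h𝔟, hcop, hid, hv⟩
  have h := hs.mul_unitEmbedding_inv K τ a⁻¹
  rwa [map_inv, inv_inv] at h

/-- **Degree-one UNRAMIFIED PRIME representative inside the class** (`K` totally complex): if `s ↔ σ` then `s·a ↔ σ` for some `a ∈ Kˣ` with `(s·a) = 𝔮` a prime
`∉ S` (any finite `S`), `𝔮 ∤ 𝔪`, `N𝔮 = q` prime, `𝔮² ∤ (q)`, and `s·a ≡ 1 mod 𝔪` — ★ `exists_mul_unitEmbedding_prime_congr` (Landau) inside the class.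
[cite: Milne2005ShimuraVarieties, (59) p. 107] [cite: Landau1918Idealklassen, §1 Satz] [cite: NeukirchANT1999, Ch. VI §1 Prop. (1.9) pp. 364–365] -/
theorem IsArtinCorrespondent.exists_mul_unitEmbedding_prime_congr {τ : K →+* ℂ} {σ : ℂ ≃+* ℂ} {s : (FiniteAdeleRing (𝓞 K) K)ˣ}
    (hs : IsArtinCorrespondent K τ s σ) {𝔪 : Ideal (𝓞 K)} (h𝔪 : 𝔪 ≠ ⊥) (S : Set (HeightOneSpectrum (𝓞 K))) (hS : S.Finite) :
    ∃ (a : Kˣ) (v : HeightOneSpectrum (𝓞 K)),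
      IsArtinCorrespondent K τ (s * FiniteAdeleRing.unitEmbedding (𝓞 K) K a) σ ∧ v ∉ S ∧ ¬ 𝔪 ≤ v.asIdeal ∧ (Ideal.absNorm v.asIdeal).Prime ∧
      ¬ v.asIdeal ^ 2 ∣ Ideal.span {((Ideal.absNorm v.asIdeal : ℕ) : 𝓞 K)} ∧
      Literature.NumberTheory.Automorphic.FiniteAdeleRing.toFractionalIdeal (𝓞 K) K (s * FiniteAdeleRing.unitEmbedding (𝓞 K) K a) =
        (v.asIdeal : FractionalIdeal (𝓞 K)⁰ K) ∧
      ∀ v' : HeightOneSpectrum (𝓞 K), 𝔪 ≤ v'.asIdeal →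
        Valued.v (((s * FiniteAdeleRing.unitEmbedding (𝓞 K) K a : (FiniteAdeleRing (𝓞 K) K)ˣ) : FiniteAdeleRing (𝓞 K) K) v') = 1 ∧
        Valued.v (((s * FiniteAdeleRing.unitEmbedding (𝓞 K) K a : (FiniteAdeleRing (𝓞 K) K)ˣ) : FiniteAdeleRing (𝓞 K) K) v' - 1) ≤
          WithZero.exp (-(modulusExp 𝔪 v' : ℤ)) := by
  obtain ⟨a, v, hvS, hv𝔪, hq, h2, hid, hv⟩ :=
    Literature.NumberTheory.LFunctions.exists_mul_unitEmbedding_prime_congr h𝔪 s S hS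
  refine ⟨a, v, ?_, hvS, hv𝔪, hq, h2, hid, hv⟩
  have h := hs.mul_unitEmbedding_inv K τ a⁻¹
  rwa [map_inv, inv_inv] at h

/-- **TOTALLY SPLIT PRIME representative inside the class** (`K ∕ ℚ` Galois, totally complex): as `exists_mul_unitEmbedding_prime_congr`, with the orbit map
`g ↦ g•𝔮` INJECTIVE on `Gal(K∕ℚ)` (★ `smul_injective_of_not_sq_dvd_span_absNorm`) — the input of row (d) «coprime to its conjugate» of the twist data
(★ `F0P6aTwistDataCoprime.typeProd_sup_complexConj_smul_typeProd_eq_top`). [cite: Landau1918Idealklassen, §1 Satz] [cite: NeukirchANT1999, Ch. I §9] -/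
theorem IsArtinCorrespondent.exists_mul_unitEmbedding_splitPrime_congr [IsGalois ℚ K] {τ : K →+* ℂ} {σ : ℂ ≃+* ℂ}
    {s : (FiniteAdeleRing (𝓞 K) K)ˣ} (hs : IsArtinCorrespondent K τ s σ) {𝔪 : Ideal (𝓞 K)} (h𝔪 : 𝔪 ≠ ⊥)
    (S : Set (HeightOneSpectrum (𝓞 K))) (hS : S.Finite) :
    ∃ (a : Kˣ) (v : HeightOneSpectrum (𝓞 K)),
      IsArtinCorrespondent K τ (s * FiniteAdeleRing.unitEmbedding (𝓞 K) K a) σ ∧ v ∉ S ∧ ¬ 𝔪 ≤ v.asIdeal ∧ (Ideal.absNorm v.asIdeal).Prime ∧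
      (Function.Injective fun g : K ≃ₐ[ℚ] K => g • v) ∧
      Literature.NumberTheory.Automorphic.FiniteAdeleRing.toFractionalIdeal (𝓞 K) K (s * FiniteAdeleRing.unitEmbedding (𝓞 K) K a) =
        (v.asIdeal : FractionalIdeal (𝓞 K)⁰ K) ∧
      ∀ v' : HeightOneSpectrum (𝓞 K), 𝔪 ≤ v'.asIdeal →
        Valued.v (((s * FiniteAdeleRing.unitEmbedding (𝓞 K) K a : (FiniteAdeleRing (𝓞 K) K)ˣ) : FiniteAdeleRing (𝓞 K) K) v') = 1 ∧
        Valued.v (((s * FiniteAdeleRing.unitEmbedding (𝓞 K) K a : (FiniteAdeleRing (𝓞 K) K)ˣ) : FiniteAdeleRing (𝓞 K) K) v' - 1) ≤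
          WithZero.exp (-(modulusExp 𝔪 v' : ℤ)) := by
  obtain ⟨a, v, hsa, hvS, hv𝔪, hq, h2, hid, hv⟩ := hs.exists_mul_unitEmbedding_prime_congr K h𝔪 S hS
  exact ⟨a, v, hsa, hvS, hv𝔪, hq, Literature.NumberTheory.LFunctions.smul_injective_of_not_sq_dvd_span_absNorm h2, hid, hv⟩

end TotallyComplex

/-! ## §2 The reflex compositum `E♯` of a Galois CM field is Galois over `ℚ` -/

namespace Aux

variable (F : Type) [Field F] [NumberField F] [IsCMField F]

omit [IsCMField F] in
/-- **`E♯ = reflexField F Φ ι₁` is Galois over `ℚ` when `F ∕ ℚ` is** (`E♯ = ι₁(F)` as an intermediate field of `ℂ ∕ ℚ`, ★ `reflexField_eq_fieldRange_of_isGalois`;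
transport `IsGalois` along `F ≃ₐ[ℚ] ι₁(F) ≃ₐ[ℚ] E♯`, Mathlib `AlgHom.equivFieldRange` ∕ `IntermediateField.equivOfEq`).  A `theorem`, not an instance.
[cite: Shimura1998, §8.3 Prop. 28] [cite: Liu2021, App. C Rem. C.15 (p. 113)] -/
theorem isGalois_reflexField_of_isGalois [IsGalois ℚ F] (Φ : Literature.AlgebraicGeometry.Motives.CMType F) (ι₁ : F →+* ℂ) :
    IsGalois ℚ ↥(reflexField F Φ ι₁) :=
  IsGalois.of_algEquiv
    ((ι₁.toRatAlgHom.equivFieldRange).trans (IntermediateField.equivOfEq (reflexField_eq_fieldRange_of_isGalois F Φ ι₁).symm))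

/-! ## §3 One call over `E♯`: a correspondent of `σ ∈ Aut(ℂ∕E♯)` whose ideal is a prescribed kind of representative -/

/-- **Every `σ ∈ Aut(ℂ∕E♯)` has a LEVEL-ADAPTED INTEGRAL Artin correspondent over `E♯`**: `u ∈ 𝔸_{E♯,f}^×`, `u ↔ σ`, `(u) = 𝔟` integral with `𝔟 + 𝔪 = (1)`,
`u ≡ 1 mod 𝔪` at the primes of `𝔪` (★ `exists_finiteIdele_isArtinCorrespondent_reflexField` + §1). [cite: Milne2005ShimuraVarieties, (59) p. 107; Def. 12.8 (62) p. 114]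
[cite: NeukirchANT1999, Ch. VI §1 Prop. (1.9) pp. 364–365] -/
theorem exists_isArtinCorrespondent_reflexField_integral_congr (Φ : Literature.AlgebraicGeometry.Motives.CMType F) (ι₁ : F →+* ℂ)
    (σ : ℂ ≃+* ℂ) (hσ : ∀ x : ↥(reflexField F Φ ι₁), σ (algebraMap ↥(reflexField F Φ ι₁) ℂ x) = algebraMap ↥(reflexField F Φ ι₁) ℂ x) :
    haveI : NumberField ↥(reflexField F Φ ι₁) := numberField_reflexField F Φ ι₁
    ∀ {𝔪 : Ideal (𝓞 ↥(reflexField F Φ ι₁))}, 𝔪 ≠ ⊥ →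
    ∃ (u : (FiniteAdeleRing (𝓞 ↥(reflexField F Φ ι₁)) ↥(reflexField F Φ ι₁))ˣ) (𝔟 : Ideal (𝓞 ↥(reflexField F Φ ι₁))),
      IsArtinCorrespondent ↥(reflexField F Φ ι₁) (algebraMap ↥(reflexField F Φ ι₁) ℂ) u σ ∧ 𝔟 ≠ ⊥ ∧ IsCoprime 𝔟 𝔪 ∧
      Literature.NumberTheory.Automorphic.FiniteAdeleRing.toFractionalIdeal (𝓞 ↥(reflexField F Φ ι₁)) ↥(reflexField F Φ ι₁) u =
        (𝔟 : FractionalIdeal (𝓞 ↥(reflexField F Φ ι₁))⁰ ↥(reflexField F Φ ι₁)) ∧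
      ∀ v : HeightOneSpectrum (𝓞 ↥(reflexField F Φ ι₁)), 𝔪 ≤ v.asIdeal →
        Valued.v ((u : FiniteAdeleRing (𝓞 ↥(reflexField F Φ ι₁)) ↥(reflexField F Φ ι₁)) v) = 1 ∧
        Valued.v ((u : FiniteAdeleRing (𝓞 ↥(reflexField F Φ ι₁)) ↥(reflexField F Φ ι₁)) v - 1) ≤ WithZero.exp (-(modulusExp 𝔪 v : ℤ)) := by
  haveI : NumberField ↥(reflexField F Φ ι₁) := numberField_reflexField F Φ ι₁
  haveI : IsTotallyComplex ↥(reflexField F Φ ι₁) := isTotallyComplex_reflexField F Φ ι₁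
  intro 𝔪 h𝔪
  obtain ⟨u₀, hu₀⟩ := exists_finiteIdele_isArtinCorrespondent_reflexField F Φ ι₁ σ hσ
  obtain ⟨a, 𝔟, hua, h𝔟, hcop, hid, hv⟩ := hu₀.exists_mul_unitEmbedding_integral_congr ↥(reflexField F Φ ι₁) h𝔪
  exact ⟨u₀ * FiniteAdeleRing.unitEmbedding (𝓞 ↥(reflexField F Φ ι₁)) ↥(reflexField F Φ ι₁) a, 𝔟, hua, h𝔟, hcop, hid, hv⟩

/-- **Every `σ ∈ Aut(ℂ∕E♯)` has a TOTALLY-SPLIT-PRIME Artin correspondent over `E♯`** (`F ∕ ℚ` Galois, so `E♯ = ι₁(F)` is Galois): `u ↔ σ` with `(u) = 𝔮` a prime of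
`E♯` outside any finite set `S`, `𝔮 ∤ 𝔪`, `N𝔮 = q` prime, `g ↦ g•𝔮` injective on `Gal(E♯∕ℚ)`, `u ≡ 1 mod 𝔪` — the `u` from which (S2a)՚s central twist
`t = N_{E♯,Φ}(u)` gets an ideal that is a CM-type product of a totally split prime (rows (a)(b)(c)(d)(e) of ★ `F0P6aTwistDataCoprime`).
[cite: Milne2005ShimuraVarieties, (59) p. 107; Def. 12.8 (62) p. 114] [cite: Landau1918Idealklassen, §1 Satz] [cite: NeukirchANT1999, Ch. I §9; Ch. VI §1 Prop. (1.9)] -/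
theorem exists_isArtinCorrespondent_reflexField_splitPrime_congr [IsGalois ℚ F] (Φ : Literature.AlgebraicGeometry.Motives.CMType F) (ι₁ : F →+* ℂ)
    (σ : ℂ ≃+* ℂ) (hσ : ∀ x : ↥(reflexField F Φ ι₁), σ (algebraMap ↥(reflexField F Φ ι₁) ℂ x) = algebraMap ↥(reflexField F Φ ι₁) ℂ x) :
    haveI : NumberField ↥(reflexField F Φ ι₁) := numberField_reflexField F Φ ι₁
    ∀ {𝔪 : Ideal (𝓞 ↥(reflexField F Φ ι₁))}, 𝔪 ≠ ⊥ → ∀ (S : Set (HeightOneSpectrum (𝓞 ↥(reflexField F Φ ι₁)))), S.Finite →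
    ∃ (u : (FiniteAdeleRing (𝓞 ↥(reflexField F Φ ι₁)) ↥(reflexField F Φ ι₁))ˣ) (v : HeightOneSpectrum (𝓞 ↥(reflexField F Φ ι₁))),
      IsArtinCorrespondent ↥(reflexField F Φ ι₁) (algebraMap ↥(reflexField F Φ ι₁) ℂ) u σ ∧ v ∉ S ∧ ¬ 𝔪 ≤ v.asIdeal ∧
      (Ideal.absNorm v.asIdeal).Prime ∧ (Function.Injective fun g : ↥(reflexField F Φ ι₁) ≃ₐ[ℚ] ↥(reflexField F Φ ι₁) => g • v) ∧
      Literature.NumberTheory.Automorphic.FiniteAdeleRing.toFractionalIdeal (𝓞 ↥(reflexField F Φ ι₁)) ↥(reflexField F Φ ι₁) u =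
        (v.asIdeal : FractionalIdeal (𝓞 ↥(reflexField F Φ ι₁))⁰ ↥(reflexField F Φ ι₁)) ∧
      ∀ v' : HeightOneSpectrum (𝓞 ↥(reflexField F Φ ι₁)), 𝔪 ≤ v'.asIdeal →
        Valued.v ((u : FiniteAdeleRing (𝓞 ↥(reflexField F Φ ι₁)) ↥(reflexField F Φ ι₁)) v') = 1 ∧
        Valued.v ((u : FiniteAdeleRing (𝓞 ↥(reflexField F Φ ι₁)) ↥(reflexField F Φ ι₁)) v' - 1) ≤ WithZero.exp (-(modulusExp 𝔪 v' : ℤ)) := by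
  haveI : NumberField ↥(reflexField F Φ ι₁) := numberField_reflexField F Φ ι₁
  haveI : IsTotallyComplex ↥(reflexField F Φ ι₁) := isTotallyComplex_reflexField F Φ ι₁
  haveI : IsGalois ℚ ↥(reflexField F Φ ι₁) := isGalois_reflexField_of_isGalois F Φ ι₁
  intro 𝔪 h𝔪 S hS
  obtain ⟨u₀, hu₀⟩ := exists_finiteIdele_isArtinCorrespondent_reflexField F Φ ι₁ σ hσ
  obtain ⟨a, v, hua, hvS, hv𝔪, hq, hinj, hid, hv⟩ := hu₀.exists_mul_unitEmbedding_splitPrime_congr ↥(reflexField F Φ ι₁) h𝔪 S hS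
  exact ⟨u₀ * FiniteAdeleRing.unitEmbedding (𝓞 ↥(reflexField F Φ ι₁)) ↥(reflexField F Φ ι₁) a, v, hua, hvS, hv𝔪, hq, hinj, hid, hv⟩

end Aux

end UnitaryCanonicalModel

end Literature.AlgebraicGeometry.ShimuraVarieties

end
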